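import Summits.KontsevichZagierPeriods.Zeta5Search.Certificates.RayC1KernelPeriodicBricks
import Summits.KontsevichZagierPeriods.Zeta5Search.Certificates.RayC1KernelClassR1
import HarnessLib

/-!
# ζ(5) search — certificates: WORKED INSTANCE of the periodic consumer — typer's round-R1 window table (θ > 1/4) + the brick periodic table at `m₁ = 4` (CERT-1 g6)

HONEST FRAMING: systematic search; no irrationality claim unless certified.  Valuation bookkeeping; the exponent below is `< 1` —
a calibration of the T1-map ray C1 (λ* = 108.2193 is the certified tie; NO crossing, none claimed), NOT a ladder top (typer's rounds
R3/R4 consume more windows); nothing about the arithmetic nature of `ζ(5)`.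

OUR work (Summit side; cert-1 seat, generation 6).  The end-to-end template for `gen_classround.py --periodic`: typer g17's round-R1
table `c1TabR1 = c1Low ++ c1HiR1` (bricks `m ≤ 3` + class windows, all above `θ = 1/4`, rate `R = 229.5236`, `c1CWR1_holds`) as the
WINDOW table, and cert-1's `c1PerBricks` (all 772 `ν`-cells) as the PERIODIC table consumed at every shift `m ≥ 4` (`Rp = 1.1391629`,
`c1PerBricks_rate4_ge`) — replacing the 9 264-row `c1Deep*` tables AND the uniform tail by ONE 772-row periodic table:
* `c1TabR1_head4 : headGE 4 c1TabR1` (one `decide`);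
* **`c1_exponent_periodicR1` — HYPOTHESIS-FREE: every `0 ≤ γ ≤ 0.8088` is an effective exponent of the ray** with the multiplier
  `kMP c1TabR1 c1PerBricks 4` (`λ = 359.4247 − 229.5236 − 1.1392 + 0.01 = 128.7719`; `0.8088·(128.7719 + 182.9376) < 182.9374 + 69.1961`;
  R1 alone gave `0.8058` at `λ = 129.9111`).
-/

noncomputable section

open Finset Real Filter Topology

namespace Summit.KontsevichZagierPeriods.Zeta5Search.RayC1

open Summit.KontsevichZagierPeriods.Zeta5Search.RayKernel
open Literature.NumberTheory.Transcendental (zetaValue)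

/-- The round-R1 table starts above `θ = 1/4`. -/
theorem c1TabR1_head4 : headGE 4 c1TabR1 = true := by decide +kernel

/-- **THE EXPONENT `0.8088` OF THE RAY RayC1 from round R1's windows + the brick periodic table at `m₁ = 4`, HYPOTHESIS-FREE.**
For every `0 ≤ γ ≤ 0.8088`, eventually `|ζ(5) − P_n/Q(a·n)| < 1/q_n^γ` with the integers `p_n = kMP c1TabR1 c1PerBricks 4 n·P_n`,
`q_n = kMP c1TabR1 c1PerBricks 4 n·|Q(a·n)| ≥ 1`.  No irrationality content (`γ < 1`); not a ladder top. -/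
theorem c1_exponent_periodicR1 {γ : ℝ} (hγ0 : 0 ≤ γ) (hγ : γ ≤ 1011 / 1250) :
    ∀ᶠ n : ℕ in atTop, ∃ p : ℤ, ∃ q : ℕ, 1 ≤ q ∧ (q : ℚ) = kMP c1TabR1 c1PerBricks 4 n * |(c1Q n : ℚ)| ∧
      (p : ℚ) = kMP c1TabR1 c1PerBricks 4 n * c1P n ∧ |zetaValue 5 - (c1P n : ℝ) / (c1Q n : ℝ)| < 1 / (q : ℝ) ^ γ := by
  have hq : ((((3594247 / 10000 - (2901694564104031395733681077374029367754852960857290783315426314018359866345671368677526769653 / 12642249357268204940248303747851869483230814882620880520125200161585307502157928119719064000 : ℚ) - 11391629 / 10000000 + 1 / 100 : ℚ)) : ℝ)) =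
      (((3594247 / 10000 - (2901694564104031395733681077374029367754852960857290783315426314018359866345671368677526769653 / 12642249357268204940248303747851869483230814882620880520125200161585307502157928119719064000 : ℚ) - 11391629 / 10000000 + 1 / 100 : ℚ)) : ℝ) := rfl
  have key := c1_exponent_of_tables (tab := c1TabR1) (ptab := c1PerBricks) (m₁ := 4)
    (soundChecker_entryOK c1CWR1_holds (NT := 1360) le_rfl) (by norm_num) c1TabR1_ok c1TabR1_chain (by norm_num) c1TabR1_head4
    c1TabR1_rate psound_bricks_one c1PerBricks_ok c1PerBricks_chain c1PerBricks_rate4_ge hγ0 ?_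
  · exact key
  · push_cast
    nlinarith

end Summit.KontsevichZagierPeriods.Zeta5Search.RayC1
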